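import Summits.BirchSwinnertonDyer.BirchSwinnertonDyer.Theses.LeadingTerm
import Literature.NumberTheory.EllipticCurves.HeegnerPointsKolyvaginTorsionProofs
import Literature.NumberTheory.EllipticCurves.ComplexMultiplicationRationalJIntegralProofs
import Literature.NumberTheory.EllipticCurves.SzpiroLocalDataProofs
import Literature.NumberTheory.EllipticCurves.DegreeConjectureAbcPrelims

/-!
# `LeadingTerm.TamePinchR` (crux stmt-BirchSwinnertonDyer-17007): admissible primes avoid the
# rational-torsion (isogeny) primes of NON-CM curves too (negative-side support; this file does NOT
# refute the crux)

The `∃ p` of `TamePinchR` asks for a prime with `ρ̄_{W,p} : Γ_ℚ → Aut(E[p])` ONTO. For a CM curve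
no odd prime qualifies (the refuted parent `TamePinch`, `Negative/NonCMLoadBearing.lean`); this file
records, kernel-checked, that for NON-CM curves the admissible primes still have to dodge a genuine
(finite, Serre 1972) exceptional set: a curve with a rational point of order `p` (`p` odd) has
non-surjective — indeed reducible — mod-`p` image.

* `not_hasSurjectiveModNGaloisRep_of_zsmul_eq_zero` — **rational `p`-torsion kills
  surjectivity** (`p` odd): if `0 ≠ P ∈ E(ℚ)` with `p·P = 0` then `¬ W.HasSurjectiveModNGaloisRep p`.
  Proof: base-change `P` to a quadratic field `K = ℚ(ζ₃)` (injective on points) and apply the tree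
  theorem `torsionBy_eq_bot_of_hasSurjectiveModNGaloisRep` (`E(K)[p] = 0` for `[K:ℚ] = 2` when
  `ρ̄` is onto; Gross 1991 §2).
* `elevenA3_exists_five_torsion` — on 11a3 = `[0,−1,1,0,0]` (`y² + y = x³ − x²`) the point
  `P = (0,0)` has order `5`: `2P = (1,−1)`, `2P + P = (1,0) = −2P`, `5P = 0` (explicit chord–tangent
  computation with Mathlib's group law).
* `elevenA3_not_hasSurjectiveModNGaloisRep_five`, `isElliptic_elevenA3`,
  `isGloballyMinimal_elevenA3` (`Δ = −11`), `not_hasCM_elevenA3` (`j = −2¹²/11`, `‖j‖₁₁ = 11 > 1`):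
  11a3 is an elliptic, globally minimal, NON-CM curve with good reduction at `5` whose mod-`5`
  representation is not surjective.
* `seven_le_of_tamePinchR_elevenA3` — consequently the prime that `TamePinchR` produces for 11a3
  is `≥ 7`: the crux's `∃ p` provably skips the isogeny prime even though `5` is a prime of good
  reduction — a non-CM instance of exceptional set (ii) of `Cruxes/TamePinchR/Disproof.lean`.

Standing-disprover seat refuter-cdisprove-stmt-BirchSwinnertonDyer-17007-0, cycle 1. Theorem-only.
-/

noncomputable section

-- D-0017: single-problem summit, so `Summit.BirchSwinnertonDyer.BirchSwinnertonDyer.…` repeats a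
-- namespace BY DESIGN.
set_option linter.dupNamespace false

namespace Summit.BirchSwinnertonDyer.BirchSwinnertonDyer.Theorems.TamePinchR.Negative

open scoped MatrixGroups ModularForm
open CongruenceSubgroup IsDedekindDomain Literature.NumberTheory.EllipticCurves
  Literature.NumberTheory.EllipticCurves.ModularForms
open WeierstrassCurve

/-! ### Rational torsion kills surjectivity -/

/-- **A rational point of odd prime order `p` makes `ρ̄_{E,p}` non-surjective.** If `W/ℚ` is
elliptic and `0 ≠ P ∈ E(ℚ)` with `p • P = 0` (`p` an odd prime), then the mod-`p` Galois
representation is not onto `Aut(E[p])`: the base change of `P` to the quadratic field `ℚ(ζ₃)` is a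
non-zero `p`-torsion point, contradicting `E(K)[p] = 0` for quadratic `K` under surjectivity (tree
theorem `torsionBy_eq_bot_of_hasSurjectiveModNGaloisRep`, Gross 1991 §2). [folklore] -/
theorem not_hasSurjectiveModNGaloisRep_of_zsmul_eq_zero (W : WeierstrassCurve ℚ) [W.IsElliptic]
    {p : ℕ} (hp : p.Prime) (hp2 : p ≠ 2) (P : (W.baseChange ℚ).toAffine.Point) (hP0 : P ≠ 0)
    (hP : (p : ℤ) • P = 0) : ¬ W.HasSurjectiveModNGaloisRep p := by
  classical
  intro hρ
  haveI : NeZero (3 : ℕ) := ⟨by norm_num⟩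
  haveI : IsCyclotomicExtension {3} ℚ (CyclotomicField 3 ℚ) :=
    CyclotomicField.isCyclotomicExtension 3 ℚ
  have hK : Module.finrank ℚ (CyclotomicField 3 ℚ) = 2 := by
    rw [IsCyclotomicExtension.finrank (CyclotomicField 3 ℚ)
      (Polynomial.cyclotomic.irreducible_rat (n := 3) (by norm_num)), Nat.totient_prime Nat.prime_three]
  have hbot := torsionBy_eq_bot_of_hasSurjectiveModNGaloisRep W (CyclotomicField 3 ℚ) hK hp hp2 hρ
  let φ : (W.baseChange ℚ).toAffine.Point →+ (W.baseChange (CyclotomicField 3 ℚ)).toAffine.Point :=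
    WeierstrassCurve.Affine.Point.map (W' := W.toAffine) (Algebra.ofId ℚ (CyclotomicField 3 ℚ))
  have hinj : Function.Injective φ := WeierstrassCurve.Affine.Point.map_injective _
  have hmem : φ P ∈ AddSubgroup.torsionBy (W.baseChange (CyclotomicField 3 ℚ)).toAffine.Point (p : ℤ) := by
    refine (Submodule.mem_torsionBy_iff (p : ℤ) (φ P)).mpr ?_
    rw [← map_zsmul φ, hP, map_zero]
  have h0 : φ P = 0 := (AddSubgroup.eq_bot_iff_forall _).mp hbot _ hmem
  exact hP0 (hinj (by rw [h0, map_zero]))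

/-! ### 11a3 = `[0,−1,1,0,0]`: the point `(0,0)` has order `5` -/

/-- `Δ(11a3) = −11`. [folklore] -/
theorem Δ_elevenA3 : (⟨0, -1, 1, 0, 0⟩ : WeierstrassCurve ℚ).Δ = -11 := by
  simp only [WeierstrassCurve.Δ, WeierstrassCurve.b₂, WeierstrassCurve.b₄, WeierstrassCurve.b₆,
    WeierstrassCurve.b₈]
  norm_num

/-- `c₄(11a3) = 16`. [folklore] -/
theorem c₄_elevenA3 : (⟨0, -1, 1, 0, 0⟩ : WeierstrassCurve ℚ).c₄ = 16 := by
  simp only [WeierstrassCurve.c₄, WeierstrassCurve.b₂, WeierstrassCurve.b₄]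
  norm_num

/-- 11a3 is an elliptic curve. [folklore] -/
theorem isElliptic_elevenA3 : (⟨0, -1, 1, 0, 0⟩ : WeierstrassCurve ℚ).IsElliptic :=
  ⟨by rw [Δ_elevenA3]; exact isUnit_iff_ne_zero.mpr (by norm_num)⟩

/-- The integral model base-changes to the rational one. [folklore] -/
theorem baseChange_int_elevenA3 :
    ((⟨0, -1, 1, 0, 0⟩ : WeierstrassCurve ℤ).baseChange ℚ) = (⟨0, -1, 1, 0, 0⟩ : WeierstrassCurve ℚ) := by
  simp only [WeierstrassCurve.baseChange, WeierstrassCurve.map]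
  ext <;> simp

/-- 11a3 is a global minimal model (`q¹² ∤ 11`). [folklore] -/
theorem isGloballyMinimal_elevenA3 : (⟨0, -1, 1, 0, 0⟩ : WeierstrassCurve ℚ).IsGloballyMinimal := by
  rw [← baseChange_int_elevenA3]
  refine isGloballyMinimal_of_forall_isMinimalAt_int _ fun v ↦ ?_
  refine isMinimalAt_baseChange_int_of_not_pow_dvd_Δ ?_
  intro h
  have hΔ : (⟨0, -1, 1, 0, 0⟩ : WeierstrassCurve ℤ).Δ = -11 := by
    simp only [WeierstrassCurve.Δ, WeierstrassCurve.b₂, WeierstrassCurve.b₄, WeierstrassCurve.b₆,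
      WeierstrassCurve.b₈]
    norm_num
  rw [hΔ, dvd_neg] at h
  have hp := Rat.HeightOneSpectrum.prime_natGenerator v
  have h' : Rat.HeightOneSpectrum.natGenerator v ^ 12 ∣ 11 := by exact_mod_cast h
  have hle : Rat.HeightOneSpectrum.natGenerator v ^ 12 ≤ 11 := Nat.le_of_dvd (by norm_num) h'
  have hge : 2 ^ 12 ≤ Rat.HeightOneSpectrum.natGenerator v ^ 12 := Nat.pow_le_pow_left hp.two_le 12
  have := hge.trans hle
  norm_num at this

/-- 11a3 has no complex multiplication: `j = 16³/(−11)` has `‖j‖₁₁ = 11 > 1` and CM `j`-invariants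
are integers (`not_hasCM_of_one_lt_norm_j`). [folklore] -/
theorem not_hasCM_elevenA3 :
    haveI := isElliptic_elevenA3
    ¬ (⟨0, -1, 1, 0, 0⟩ : WeierstrassCurve ℚ).HasCM := by
  haveI := isElliptic_elevenA3
  haveI : Fact (Nat.Prime 11) := ⟨by norm_num⟩
  refine not_hasCM_of_one_lt_norm_j _ (ℓ := 11) ?_
  have hj : ((⟨0, -1, 1, 0, 0⟩ : WeierstrassCurve ℚ).j : ℚ) = (-11 : ℚ)⁻¹ * 16 ^ 3 := by
    rw [WeierstrassCurve.j, Units.val_inv_eq_inv_val, WeierstrassCurve.coe_Δ', Δ_elevenA3, c₄_elevenA3,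
      mul_comm]
  rw [hj]
  push_cast
  rw [norm_mul, norm_inv, norm_neg, norm_pow]
  have h11 : ‖(11 : ℚ_[11])‖ = (11 : ℝ)⁻¹ := by
    have h := @Padic.norm_p 11 _
    exact_mod_cast h
  have h16 : ‖(16 : ℚ_[11])‖ = 1 := by
    have hle : ‖((16 : ℤ) : ℚ_[11])‖ ≤ 1 := Padic.norm_int_le_one 16
    have hlt : ¬ ‖((16 : ℤ) : ℚ_[11])‖ < 1 := by
      rw [Padic.norm_intCast_lt_one_iff]; norm_num
    push_cast at hle hlt
    exact le_antisymm hle (not_lt.mp hlt)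
  rw [h11, h16]
  norm_num

/-- The base change of 11a3 along `ℚ → ℚ` is 11a3. [folklore] -/
theorem baseChange_rat_elevenA3 :
    ((⟨0, -1, 1, 0, 0⟩ : WeierstrassCurve ℚ).baseChange ℚ) = (⟨0, -1, 1, 0, 0⟩ : WeierstrassCurve ℚ) := by
  simp only [WeierstrassCurve.baseChange, WeierstrassCurve.map]
  ext <;> simp

/-- **`(0,0)` is a point of order `5` on 11a3** (`y² + y = x³ − x²`): `2P = (1,−1)`,
`2P + P = (1, 0) = −2P`, hence `5P = (2P + P) + 2P = 0`; and `P ≠ O`. (Cremona's table: 11a3 has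
torsion `ℤ/5` generated by `(0,0)`.) [folklore] -/
theorem elevenA3_exists_five_torsion :
    ∃ P : ((⟨0, -1, 1, 0, 0⟩ : WeierstrassCurve ℚ).baseChange ℚ).toAffine.Point,
      P ≠ 0 ∧ (5 : ℤ) • P = 0 := by
  rw [baseChange_rat_elevenA3]
  have h00 : (⟨0, -1, 1, 0, 0⟩ : WeierstrassCurve ℚ).toAffine.Nonsingular 0 0 := by
    rw [WeierstrassCurve.Affine.nonsingular_iff', WeierstrassCurve.Affine.equation_iff]; norm_num
  have h1m : (⟨0, -1, 1, 0, 0⟩ : WeierstrassCurve ℚ).toAffine.Nonsingular 1 (-1) := by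
    rw [WeierstrassCurve.Affine.nonsingular_iff', WeierstrassCurve.Affine.equation_iff]; norm_num
  have h10 : (⟨0, -1, 1, 0, 0⟩ : WeierstrassCurve ℚ).toAffine.Nonsingular 1 0 := by
    rw [WeierstrassCurve.Affine.nonsingular_iff', WeierstrassCurve.Affine.equation_iff]; norm_num
  refine ⟨.some 0 0 h00, WeierstrassCurve.Affine.Point.some_ne_zero h00, ?_⟩
  -- 2P = (1, -1)
  have h2 : (.some 0 0 h00 : (⟨0, -1, 1, 0, 0⟩ : WeierstrassCurve ℚ).toAffine.Point) + .some 0 0 h00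
      = .some 1 (-1) h1m := by
    rw [WeierstrassCurve.Affine.Point.add_self_of_Y_ne
      (by rw [WeierstrassCurve.Affine.negY]; norm_num)]
    simp only [WeierstrassCurve.Affine.Point.some.injEq]
    rw [WeierstrassCurve.Affine.slope_of_Y_ne rfl (by rw [WeierstrassCurve.Affine.negY]; norm_num)]
    simp only [WeierstrassCurve.Affine.addX, WeierstrassCurve.Affine.addY,
      WeierstrassCurve.Affine.negAddY, WeierstrassCurve.Affine.negY]
    norm_num
  -- 2P + P = (1, 0)
  have h3 : (.some 1 (-1) h1m : (⟨0, -1, 1, 0, 0⟩ : WeierstrassCurve ℚ).toAffine.Point) + .some 0 0 h00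
      = .some 1 0 h10 := by
    rw [WeierstrassCurve.Affine.Point.add_of_X_ne (by norm_num)]
    simp only [WeierstrassCurve.Affine.Point.some.injEq]
    rw [WeierstrassCurve.Affine.slope_of_X_ne (by norm_num)]
    simp only [WeierstrassCurve.Affine.addX, WeierstrassCurve.Affine.addY,
      WeierstrassCurve.Affine.negAddY, WeierstrassCurve.Affine.negY]
    norm_num
  -- -(2P) = (1, 0)
  have hn : -(.some 1 (-1) h1m : (⟨0, -1, 1, 0, 0⟩ : WeierstrassCurve ℚ).toAffine.Point)
      = .some 1 0 h10 := by
    rw [WeierstrassCurve.Affine.Point.neg_some]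
    simp only [WeierstrassCurve.Affine.Point.some.injEq, WeierstrassCurve.Affine.negY]
    norm_num
  have h5 : (5 : ℤ) • (.some 0 0 h00 : (⟨0, -1, 1, 0, 0⟩ : WeierstrassCurve ℚ).toAffine.Point)
      = ((.some 0 0 h00 + .some 0 0 h00) + .some 0 0 h00) + (.some 0 0 h00 + .some 0 0 h00) := by
    abel
  rw [h5, h2, h3, ← hn, neg_add_cancel]

/-- **11a3 has non-surjective mod-`5` image** (rational `5`-torsion). [folklore] -/
theorem elevenA3_not_hasSurjectiveModNGaloisRep_five :
    ¬ (⟨0, -1, 1, 0, 0⟩ : WeierstrassCurve ℚ).HasSurjectiveModNGaloisRep ((5 : ℕ) : ℤ) := by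
  haveI := isElliptic_elevenA3
  obtain ⟨P, hP0, hP⟩ := elevenA3_exists_five_torsion
  exact not_hasSurjectiveModNGaloisRep_of_zsmul_eq_zero _ Nat.prime_five (by norm_num) P hP0
    (by exact_mod_cast hP)

/-- **The crux's prime skips the isogeny prime at a non-CM curve.** `TamePinchR` applied to 11a3
(elliptic, globally minimal, non-CM) yields an admissible prime `p`; since `ρ̄_{11a3,5}` is not
onto, `p ≠ 5`, so `p ≥ 7` — although `5` is a prime of good reduction for 11a3. The `∃ p` of the
crux must avoid the (finite, Serre) set of non-surjective primes of a non-CM curve, not only its bad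
primes. [folklore] -/
theorem seven_le_of_tamePinchR_elevenA3
    (h : Summit.BirchSwinnertonDyer.BirchSwinnertonDyer.Theses.LeadingTerm.TamePinchR) :
    ∃ (p : ℕ) (_ : Fact p.Prime), 7 ≤ p ∧
      @IsOrdinaryAt (⟨0, -1, 1, 0, 0⟩ : WeierstrassCurve ℚ) isGloballyMinimal_elevenA3 p _ ∧
      (⟨0, -1, 1, 0, 0⟩ : WeierstrassCurve ℚ).HasSurjectiveModNGaloisRep (p : ℤ) := by
  haveI := isElliptic_elevenA3
  haveI := isGloballyMinimal_elevenA3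
  obtain ⟨p, hp, h5, hord, hsurj, -⟩ := h ⟨0, -1, 1, 0, 0⟩ not_hasCM_elevenA3
  refine ⟨p, hp, ?_, hord, hsurj⟩
  have hp5 : p ≠ 5 := by
    rintro rfl
    exact elevenA3_not_hasSurjectiveModNGaloisRep_five hsurj
  have hp6 : p ≠ 6 := by
    rintro rfl
    exact absurd hp.out (by norm_num)
  omega

end Summit.BirchSwinnertonDyer.BirchSwinnertonDyer.Theorems.TamePinchR.Negative

end
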